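import Summits.HodgeConjecture.HodgeConjecture.Theorems.F0P6aStubFROBRoofMiddleDualTop
import HarnessLib

/-!
# `F0P6aStubFROBRoofMiddleDual` — ★ RE-HOME of `Lines/F0_P6a_StubFROBRoofMiddleDual.lean` (tree sha16 7f144f7cb2cd1e30), PART 2 of 2 — tree lines :367–:431 (LAST part: the module the `Lines/` shim and consumers import; it transitively carries parts 1–1).

See PART 1 `Theorems/F0P6aStubFROBRoofMiddleDualTop.lean` for the full ★ re-home header and the original module docstring (verbatim there).  Same namespace (every fully-qualified name unchanged);
the scopes open at the cut (`noncomputable section` ∕ `namespace` ∕ `section`s) are re-opened below with their `variable` ∕ `open` ∕ `set_option` ∕ `omit` ∕ `include` ∕ `universe` lines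
replayed verbatim from the tree, in order; the code after the replay block is the tree bytes :367–:431, untouched.  HC_CM is proved only modulo the 7 printed citations (2 remaining: hLiu418 = stmt-HodgeConjecture-24832, h413 = stmt-HodgeConjecture-24833) until rung 0 closes; a re-home is count-neutral.
-/

-- ── replay of the scopes open at tree line :367 (verbatim) ──
set_option autoImplicit false
noncomputable section
namespace Summit.HodgeConjecture.HodgeConjecture.Cruxes.HLiu418.F0P6aStubFROBRoofMiddleDual
set_option linter.dupNamespace false  -- `Summit.HodgeConjecture.HodgeConjecture.…` BY DESIGN (D-0017)
open CategoryTheory CategoryTheory.Limits NumberField IsDedekindDomain MulAction AlgebraicGeometry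
open scoped Matrix Pointwise MonObj nonZeroDivisors
open Literature.NumberTheory.GaloisRepresentations
open Literature.NumberTheory.Automorphic Literature.NumberTheory.Automorphic.UnitaryGroup
open Literature.AlgebraicGeometry.ShimuraVarieties.UnitaryCanonicalModel
open Literature.NumberTheory.Automorphic.Liu2021.AppendixC
open Literature.AlgebraicGeometry.Motives (AlgPoints IntegralModel SchemeOver thickening thickeningLift specOver relFrobeniusOver frobSpec)
open Literature.NumberTheory.DiophantineGeometry (geomResidueField specialFibreFunctor specResidueField)
open Literature.AlgebraicGeometry.RelativeSpec (ActionOver)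
open Literature.NumberTheory.EllipticCurves (genericFibre specGenericPoint)
open Literature.AlgebraicGeometry.AbelianSchemes Literature.AlgebraicGeometry.AbelianSchemes.AbelianSchemeOver
open Summit.HodgeConjecture.HodgeConjecture.Cruxes.HLiu418.F0P6aModuliDatumDefs
open Summit.HodgeConjecture.HodgeConjecture.Cruxes.HLiu418.F0P6aRGDAssembly
open Summit.HodgeConjecture.HodgeConjecture.Cruxes.HLiu418.F0P6aDatumOfInputs
open Summit.HodgeConjecture.HodgeConjecture.Cruxes.HLiu418.F0P6aQuotientFibreEngineInputs
set_option backward.isDefEq.respectTransparency false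
variable {F : Type} [Field F] [NumberField F] [IsCMField F] {ι₁ : F →+* ℂ}
    {Jstar : Matrix (Fin 2) (Fin 2) F}
    {K₀ : C5.OpenCompactSubgroup ↥(finAdelic ↥(maximalRealSubfield F) F (IsCMField.complexConj F) 2 Jstar)}
    {S : RecordSystemGS F Jstar ι₁ K₀} {hU7ₛ : S.HeckeTranslateDefinedOver}
    {hJ : (Jstar.map (IsCMField.complexConj F))ᵀ = Jstar} {hJu : IsUnit Jstar}
    {Fi : Type} [Field Fi] [Algebra F Fi] {Kc : C5.SmallLevel K₀} {G : Type} [Group G]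
    {𝓜 : IntegralModel (𝓞 F) F ((thickening F Fi).obj (S.M.obj Kc))}
    {w : HeightOneSpectrum (𝓞 F)} {hw : (IsCMField.complexConj F) • w ≠ w} {h𝓨 : (𝓜.localise w).IsSmoothProper 1}
    {θ : ActionOver (𝓜.localise w).total.hom ((Fi ≃ₐ[F] Fi) × G)}
    {e : Fi →ₐ[F] AlgebraicClosure (w.adicCompletion F)}
-- ── tree bytes :367–:431 ──

/-! ### §6 `Roof₀` AT `(x̄, x̄″)` FROM THE LEGS ROWS OF ANY `q̄` (the components of W1-a's ONE ∃-head), ALL ROWS BUT THE CONGRUENCE RELATION (rL) -/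

set_option maxHeartbeats 400000 in
/-- **THE DOWNSTAIRS ROOF, ASSEMBLED MODULO (rL), FOR A GIVEN LEG** (`q̄`-PARAMETRIC, ONE-∃ doctrine): for `I`, a Serre presentation `(E′, P, Q)` of `𝔭_w` with scalar `p`, two special
points `x̄, x̄″`, and ANY homomorphism `q̄ : A_x̄ → 𝒞_(x̄″)` (`𝒞 = I.univ ⊗ 𝔭_w⁻¹`, `sch₀Of` of the Serre family) with the legs rows of W1-a's head — (r1₀) flat + surjective, (r4₀-q)
`ι_x̄(a) ≫ q̄ = q̄ ≫ ι^𝒞(a)`, (r5₀-q) level points through the sections, (r3₀-q) FOR EVERY downstairs `(DB̄, λ_B̄)` with `c̄^*λ_B̄ = λ ≫ [p]` — and, for a co-ideal `𝔠`, the (rL) clause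
«`Ker F_q = q̄⁻¹(𝒞[𝔠])` on all `T`-points» for THIS `q̄`: `Roof₀ 𝓜 w I.univ I.act I.dual I.pol I.lvl p f 𝔭_w 𝔠 x̄ x̄″` — middle `𝒞_(x̄″)`, `DB̄`∕`λ_B̄` from §2, `c̄` the cover leg
(★ p847713: (r2₀) `comp_coverLeg_eq_one_iff_forall_mem`, surjective, (r4₀-c) `i_comp_coverLeg`, (r5₀) via `map_coverLeg_restrictPt_sectionBaseChange`), packaged by §5 `roof₀_of_rows₀`.
[cite: Liu2021, Prop. D.8 (3) p. 135, pp. 136–138] [cite: RapoportSmithlingZhang2020Diagonal, §4.3 (4.23) p. 21] [cite: MumfordAV1970, §23 Thm. 2 (p. 231)] -/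
theorem roof₀_of_legRows (I : RGDInputsAt F ι₁ Jstar K₀ S hU7ₛ hJ hJu Fi Kc G 𝓜 w hw h𝓨 θ e) [ExpChar (geomResidueField w) I.pChar]
    {m : ℕ} (E' : Matrix (Fin m) (Fin m) (𝓞 F)) (hE' : E' * E' = E') (P : Matrix (Fin m) (Fin 1) (𝓞 F)) (Q : Matrix (Fin 1) (Fin m) (𝓞 F))
    (hP : E' * P = P) (hQ : Q * E' = Q) (hQP : Q * P = Matrix.scalar (Fin 1) (I.pChar : 𝓞 F))
    (hPQ : P * Q = Matrix.scalar (Fin m) (I.pChar : 𝓞 F) * E') (h𝔭 : Ideal.span (Set.range fun k => P k 0) = w.asIdeal)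
    (xbar xbar'' : AlgPoints (𝓜.localise w).reductionAt (geomResidueField w))
    (qbar : (sch₀Of 𝓜 w I.univ xbar).X ⟶ (haveI := I.comm; (sch₀Of 𝓜 w (serreTensor I.act E' hE') xbar'').X)) [IsMonHom qbar]
    -- (r1₀)
    (h1 : Flat qbar.left ∧ Function.Surjective qbar.left.base)
    -- (r4₀-q)
    (h4q : haveI := I.comm
      ∀ a : 𝓞 F, ((I.act.baseChange (pullback.fst (𝓜.localise w).total.hom (specResidueField w))).baseChange xbar.left).i a ≫ qbar =
        qbar ≫ (((serreAction I.act E' hE').baseChange (pullback.fst (𝓜.localise w).total.hom (specResidueField w))).baseChange xbar''.left).i a)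
    -- (r5₀-q)
    (h5q : haveI := I.comm
      ∀ a : Fin I.g ⊕ Fin I.g → ZMod I.N,
        AlgPoints.map qbar ((I.univ.baseChange (pullback.fst (𝓜.localise w).total.hom (specResidueField w))).restrictPt xbar.left (I.univ.sectionBaseChange (pullback.fst (𝓜.localise w).total.hom (specResidueField w)) (I.lvl.section_ a))) =
          ((serreTensor I.act E' hE').baseChange (pullback.fst (𝓜.localise w).total.hom (specResidueField w))).restrictPt xbar''.left
            ((serreTensor I.act E' hE').sectionBaseChange (pullback.fst (𝓜.localise w).total.hom (specResidueField w)) (I.lvl.section_ a ≫ serreTranslate I.act E' hE' P)))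
    -- (r3₀-q) for EVERY downstairs `(DB̄, λ_B̄)` with `c̄^*λ_B̄ = λ ≫ [p]`
    (h3q : haveI := I.comm
      ∀ (DBs : (((serreTensor I.act E' hE').baseChange (pullback.fst (𝓜.localise w).total.hom (specResidueField w))).baseChange xbar''.left).DualPair)
        (_ : Nonempty ((Scheme.Modules.pullback (DualPair.unitHatSlice DBs)).obj DBs.P ≅ SheafOfModules.unit _))
        (lamBs : (((serreTensor I.act E' hE').baseChange (pullback.fst (𝓜.localise w).total.hom (specResidueField w))).baseChange xbar''.left).X ⟶ DBs.hat.X) [IsMonHom lamBs],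
        (haveI := isMonHom_coverLeg (pullback.fst (𝓜.localise w).total.hom (specResidueField w)) xbar''.left I.act E' hE' P
         baseChangeHom (baseChangeHom (serreTranslate I.act E' hE' P) (pullback.fst (𝓜.localise w).total.hom (specResidueField w))) xbar''.left ≫ lamBs ≫
            DualPair.dualIsogenyOver (baseChangeHom (baseChangeHom (serreTranslate I.act E' hE' P) (pullback.fst (𝓜.localise w).total.hom (specResidueField w))) xbar''.left)
              ((I.dual.baseChange (pullback.fst (𝓜.localise w).total.hom (specResidueField w))).baseChange xbar''.left) DBs =
          ((I.pol.baseChange (pullback.fst (𝓜.localise w).total.hom (specResidueField w))).baseChange xbar''.left).lam ≫ ((I.dual.baseChange (pullback.fst (𝓜.localise w).total.hom (specResidueField w))).baseChange xbar''.left).hat.mulN I.pChar) →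
        qbar ≫ lamBs ≫ DualPair.dualIsogenyOver qbar ((I.dual.baseChange (pullback.fst (𝓜.localise w).total.hom (specResidueField w))).baseChange xbar.left) DBs =
          ((I.pol.baseChange (pullback.fst (𝓜.localise w).total.hom (specResidueField w))).baseChange xbar.left).lam ≫ ((I.dual.baseChange (pullback.fst (𝓜.localise w).total.hom (specResidueField w))).baseChange xbar.left).hat.mulN I.pChar)
    -- the co-ideal and the congruence-relation clause (rL) of THIS `q̄`
    (𝔠 : Ideal (𝓞 F))
    (hL : ∀ ⦃T : SchemeOver (geomResidueField w)⦄ (t : T ⟶ (sch₀Of 𝓜 w I.univ xbar).X),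
      t ≫ relFrobeniusOver I.pChar I.fDeg (sch₀Of 𝓜 w I.univ xbar).X =
          (1 : T ⟶ ((sch₀Of 𝓜 w I.univ xbar).baseChange (frobSpec (geomResidueField w) I.pChar I.fDeg)).X) ↔
        ∀ a ∈ 𝔠, t ≫ (act₀Of 𝓜 w I.univ I.act a xbar).hom.hom.hom ≫ qbar = 1) :
    Roof₀ 𝓜 w I.univ I.act I.dual I.pol I.lvl I.pChar I.fDeg w.asIdeal 𝔠 xbar xbar'' := by
  haveI := I.comm
  have hN : I.pChar ≠ 0 := I.hpChar.1.ne_zero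
  -- the middle dual ONCE (§2)
  refine (exists_roofMiddleDual₀ I E' hE' P Q hP hQ hQP hPQ h𝔭 xbar'').elim fun DBs h => h.elim fun hDBs h => h.elim fun lamBs h => h.elim fun hlamBs hc3 => ?_
  haveI := hlamBs
  haveI := isMonHom_coverLeg (pullback.fst (𝓜.localise w).total.hom (specResidueField w)) xbar''.left I.act E' hE' P
  haveI := surjective_coverLeg_left (pullback.fst (𝓜.localise w).total.hom (specResidueField w)) xbar''.left I.act E' hE' P Q hN hP hQ hQP hPQ
  exact roof₀_of_rows₀ 𝓜 w I.univ I.act I.dual I.pol I.lvl I.pChar I.fDeg w.asIdeal 𝔠 xbar xbar''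
    (sch₀Of 𝓜 w (serreTensor I.act E' hE') xbar'') DBs lamBs hDBs qbar
    (baseChangeHom (baseChangeHom (serreTranslate I.act E' hE' P) (pullback.fst (𝓜.localise w).total.hom (specResidueField w))) xbar''.left)
    (fun a => (((serreAction I.act E' hE').baseChange (pullback.fst (𝓜.localise w).total.hom (specResidueField w))).baseChange xbar''.left).i a) h1
    (fun T t => comp_coverLeg_eq_one_iff_forall_mem (pullback.fst (𝓜.localise w).total.hom (specResidueField w)) xbar''.left I.act E' hE' P hP h𝔭 t)
    (baseChangeHom (baseChangeHom (serreTranslate I.act E' hE' P) (pullback.fst (𝓜.localise w).total.hom (specResidueField w))) xbar''.left).left.surjective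
    (h3q DBs hDBs lamBs hc3) hc3 h4q (fun a => i_comp_coverLeg (pullback.fst (𝓜.localise w).total.hom (specResidueField w)) xbar''.left I.act E' hE' P hP a)
    (fun a => (h5q a).trans (map_coverLeg_restrictPt_sectionBaseChange (pullback.fst (𝓜.localise w).total.hom (specResidueField w)) xbar''.left I.act E' hE' P (I.lvl.section_ a)).symm) hL

end Summit.HodgeConjecture.HodgeConjecture.Cruxes.HLiu418.F0P6aStubFROBRoofMiddleDual

end
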